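import Summits.Ventures.CertifiedManyBodySolver.Downfold.WorkedExamplePassDome

/-!
# The §14 worked-example PASS criteria, part 6: the THREE SEVERITIES of an engine diagnostic, and which of them
# the PASS clauses read — SOFT warnings (the C3 class of goldens S123–S127) move no worked-example word; they
# would move PASS-TV2 STAGE 1 / PASS-TV1 / PASS-TV3-LK99 only under an engine that re-classifies them as H
# incidents, and PASS-TV3-Cu not even then

Venture CertifiedManyBodySolver, cell `pub/hubbard-downfold`, seat hubbard-downfold-score-2 (session g18);
namespace `Summit.Ventures.CertifiedManyBodySolver.Downfold.WorkedExample` (parts 1–5: `WorkedExamplePass`,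
`WorkedExamplePassDome`, `WorkedExamplePassDomeReroute`, `WorkedExamplePassItem8`, `WorkedExamplePassBandsOfRecord`).
Everything here is PROVED and finite; nothing is about a material.

The layer of record it mirrors: the two engines (deputy-2 `score.py`, score-1 `phasemap.py` ≥ 1.9.4x) emit per map
three severities of diagnostic — an H1/H2/H3 INCIDENT (the run's `hard` list), a W1–W8 ERROR that REJECTS the map
(the run's `rejected` list; the map is not scored), and a printed WARNING that no clause of ACCEPTANCE §6 reads
(classes W2w / W8w / W10w / C1w and, since RUN #252, `C3: certified annex of kind energy-ordering attached at
T > 0`). `regression/v1/tv_criteria.py` (hubbard-downfold-score-2) builds the §6 words from exactly two bits per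
map: `W_clean` = not rejected ∧ delivered, `H_clean` = no hard incident naming the map. The goldens pinned on the
T-axis competing-order rows of 2026-08-29 (S123 = RUN #252: C3 ×322 on each of M13–M16; S124 ×423; S125–S127: M50
joins, ≈ 125; soft totals per La-214 map on maps/run-2026-08-29zzu = 425 · 426 · 435 · 426 · 423 · 125, hard 0,
rejected none) were registered «AS PRINTED, words ≡» on that reading. This file is the kernel form of the reading.

* §1 `Tally` = the three counts of one map's diagnostics; `wellFormed` / `hClean` = the two bits the clauses read;
  `addSoft n` (n more soft warnings) changes neither bit (`wellFormed_addSoft`, `hClean_addSoft`); `harden` (an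
  engine version that files every soft warning as an H incident) keeps `wellFormed` and makes `hClean` false iff
  a soft warning was present (`hClean_harden`).
* §2 PASS-TV2: an LSCO input assembled from a tally (`RawInput.toInput`) is LITERALLY UNCHANGED by `addSoft`
  (`RawInput.toInput_addSoft`) — so STAGE 1 and the 09-09 stage, which read the six `Input`s and nothing else, are
  unchanged for any per-map soft counts (`toSix_addSoft`, `stage1_addSoft`); under `harden` one soft warning on one
  delivered map fails STAGE 1 (`stage1_harden_eq_FAIL`). The S123-era six (router PARTIAL ×6, soft 425 … 125, hard 0):
  STAGE 1 = FAIL by the router clause with or without the soft warnings (`stage1_lsco0829`, `stage1_lsco0829_bare`);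
  the re-routed counterfactual (router AGREE ×6, same warnings) PASSES STAGE 1 as printed and FAILS it hardened
  (`stage1_lscoRerouted`, `stage1_lscoRerouted_harden`) — the precise sense of «C3 is a word-mover only under an
  engine version that makes it hard».
* §3 PASS-TV1 (H₃S) and PASS-TV3-LK99 read `hClean`: invariant under `addSoft` (`tv1_withTally_addSoft`,
  `tv3LK99_withTally_addSoft`), FAIL under `harden` with a soft warning present (`tv1_withTally_harden`,
  `tv3LK99_withTally_harden`). PASS-TV3-Cu has NO H-clean clause (ACCEPTANCE §6.3 as lettered; `tv3Cu` of part 1):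
  it is invariant under `addSoft` AND under `harden` (`tv3Cu_withTally_addSoft`, `tv3Cu_withTally_harden`) — an H
  incident on the Cu map is caught by the run's structural verdict and by rejection, never by PASS-TV3-Cu itself.

WHAT THIS IS NOT: not a scorer of record, not a ruling on whether C3 should be hard (the pen ruled it IN/soft,
deputy-2 g23), not a certification of any annex, no new number.
-/

namespace Summit.Ventures.CertifiedManyBodySolver.Downfold

namespace WorkedExample

open CellScore

/-! ## §1 The three severities, as the tally of one map's diagnostics -/

/-- The diagnostics of one map reduced to the three counts the engines print: H1/H2/H3 incidents (`hard`), W1–W8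
rejecting errors (`reject`), printed warnings no §6 clause reads (`soft`: W2w/W8w/W10w/C1w/C3 …). [folklore] -/
structure Tally where
  /-- H1/H2/H3 incidents naming the map -/
  hard : ℕ
  /-- W1–W8 errors (any one rejects the map) -/
  reject : ℕ
  /-- soft warnings (printed, read by no clause) -/
  soft : ℕ
  deriving DecidableEq, Repr

namespace Tally

/-- W-clean: the map is not rejected. [folklore] -/
def wellFormed (t : Tally) : Bool := decide (t.reject = 0)

/-- H-clean: no hard incident names the map. [folklore] -/
def hClean (t : Tally) : Bool := decide (t.hard = 0)

/-- `n` more soft warnings on the map (e.g. the C3 energy-ordering class: +322 per La-214 map at RUN #252). [folklore] -/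
def addSoft (t : Tally) (n : ℕ) : Tally := { t with soft := t.soft + n }

/-- an engine version that files every soft warning as an H incident. [folklore] -/
def harden (t : Tally) : Tally := ⟨t.hard + t.soft, t.reject, 0⟩

/-- soft warnings do not touch W-cleanliness. [folklore] -/
@[simp] theorem wellFormed_addSoft (t : Tally) (n : ℕ) : (t.addSoft n).wellFormed = t.wellFormed := rfl

/-- soft warnings do not touch H-cleanliness. [folklore] -/
@[simp] theorem hClean_addSoft (t : Tally) (n : ℕ) : (t.addSoft n).hClean = t.hClean := rfl

/-- soft warnings do not touch the hard count. [folklore] -/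
@[simp] theorem hard_addSoft (t : Tally) (n : ℕ) : (t.addSoft n).hard = t.hard := rfl

/-- the soft count adds up. [folklore] -/
@[simp] theorem soft_addSoft (t : Tally) (n : ℕ) : (t.addSoft n).soft = t.soft + n := rfl

/-- hardening does not touch W-cleanliness (a re-classified warning is an incident, not a rejection). [folklore] -/
@[simp] theorem wellFormed_harden (t : Tally) : t.harden.wellFormed = t.wellFormed := rfl

/-- the hardened hard count. [folklore] -/
@[simp] theorem hard_harden (t : Tally) : t.harden.hard = t.hard + t.soft := rfl

/-- a hardened map is H-clean iff it had neither incidents nor soft warnings. [folklore] -/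
theorem hClean_harden (t : Tally) : t.harden.hClean = true ↔ t.hard = 0 ∧ t.soft = 0 := by
  simp [hClean, harden]

/-- one soft warning present ⇒ the hardened map is not H-clean. [folklore] -/
theorem hClean_harden_of_soft_pos {t : Tally} (h : 0 < t.soft) : t.harden.hClean = false := by
  simp [hClean, harden]; omega

/-- hardening a map without soft warnings changes nothing. [folklore] -/
theorem harden_of_soft_zero {t : Tally} (h : t.soft = 0) : t.harden = t := by
  cases t with
  | mk a b c =>
    change c = 0 at h
    subst h
    simp [harden]

end Tally

/-! ## §2 PASS-TV2 (LSCO): STAGE 1 and 09-09 read the six `Input`s, and an `Input` does not see soft warnings -/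

/-- One LSCO input BEFORE reduction: delivery bit, router outcome, verdict kind, and the map's diagnostic tally. [folklore] -/
structure RawInput where
  /-- the map was delivered -/
  present : Bool
  /-- §4.2 router-word outcome -/
  router : RouterScore.Outcome
  /-- §4.5 verdict kind -/
  kind : Kind
  /-- the map's diagnostics -/
  tally : Tally

namespace RawInput

/-- the `Input` the STAGE-1 / 09-09 functions consume: W-clean bit, delivery, router, hard count, kind. [folklore] -/
def toInput (r : RawInput) : Input := ⟨r.tally.wellFormed, r.present, r.router, r.tally.hard, r.kind⟩

/-- `n` more soft warnings on this map. [folklore] -/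
def addSoft (r : RawInput) (n : ℕ) : RawInput := { r with tally := r.tally.addSoft n }

/-- this map under the hardening engine. [folklore] -/
def harden (r : RawInput) : RawInput := { r with tally := r.tally.harden }

/-- THE INPUT IS LITERALLY UNCHANGED by soft warnings. [folklore] -/
@[simp] theorem toInput_addSoft (r : RawInput) (n : ℕ) : (r.addSoft n).toInput = r.toInput := rfl

/-- … hence so is its STAGE-1 bit. [folklore] -/
theorem stage1ok_addSoft (r : RawInput) (n : ℕ) : (r.addSoft n).toInput.stage1ok = r.toInput.stage1ok := rfl

/-- under the hardening engine a map with a soft warning fails its STAGE-1 bit. [folklore] -/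
theorem stage1ok_harden_of_soft_pos {r : RawInput} (h : 0 < r.tally.soft) : r.harden.toInput.stage1ok = false := by
  rw [Bool.eq_false_iff, Ne, Input.stage1ok_iff]
  rintro ⟨-, -, -, h0⟩
  simp [harden, toInput] at h0
  omega

/-- under the hardening engine a map WITHOUT soft warnings keeps its input. [folklore] -/
theorem toInput_harden_of_soft_zero {r : RawInput} (h : r.tally.soft = 0) : r.harden.toInput = r.toInput := by
  simp [harden, Tally.harden_of_soft_zero h]

end RawInput

/-- The six LSCO inputs before reduction, in dome order. [folklore] -/
structure RawSix where
  /-- M13 La₂CuO₄ -/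
  m13 : RawInput
  /-- M14 x = 0.07 -/
  m14 : RawInput
  /-- M15 x = 0.125 -/
  m15 : RawInput
  /-- M16 x = 0.15 -/
  m16 : RawInput
  /-- M17 x = 0.22 -/
  m17 : RawInput
  /-- M50 x = 0.30 -/
  m50 : RawInput

namespace RawSix

/-- the six `Input`s. [folklore] -/
def toSix (s : RawSix) : Six :=
  ⟨s.m13.toInput, s.m14.toInput, s.m15.toInput, s.m16.toInput, s.m17.toInput, s.m50.toInput⟩

/-- soft warnings added map by map (any six counts). [folklore] -/
def addSoft (s : RawSix) (a b c d e f : ℕ) : RawSix :=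
  ⟨s.m13.addSoft a, s.m14.addSoft b, s.m15.addSoft c, s.m16.addSoft d, s.m17.addSoft e, s.m50.addSoft f⟩

/-- all six maps under the hardening engine. [folklore] -/
def harden (s : RawSix) : RawSix :=
  ⟨s.m13.harden, s.m14.harden, s.m15.harden, s.m16.harden, s.m17.harden, s.m50.harden⟩

/-- THE SIX INPUTS ARE LITERALLY UNCHANGED by any per-map soft counts … [folklore] -/
@[simp] theorem toSix_addSoft (s : RawSix) (a b c d e f : ℕ) : (s.addSoft a b c d e f).toSix = s.toSix := rfl

/-- … so STAGE 1 is unchanged (goldens S123–S127: C3 ×322 → ×446 per map, «words ≡») … [folklore] -/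
theorem stage1_addSoft (s : RawSix) (a b c d e f : ℕ) : stage1 (s.addSoft a b c d e f).toSix = stage1 s.toSix := rfl

/-- … and so is the 09-09 stage, whatever prerequisites / dome members it is evaluated with, since its kinds come
from the same six inputs. [folklore] -/
theorem stage2_addSoft (s : RawSix) (a b c d e f : ℕ) (pre : Bool) (dm : Dome) :
    stage2 pre (s.addSoft a b c d e f).toSix.kinds dm = stage2 pre s.toSix.kinds dm := rfl

/-- UNDER THE HARDENING ENGINE one soft warning on M15 (any of the six would do) fails STAGE 1. [folklore] -/
theorem stage1_harden_eq_FAIL_of_m15 {s : RawSix} (h : 0 < s.m15.tally.soft) : stage1 s.harden.toSix = .FAIL := by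
  have hmem : s.m15.harden.toInput ∈ s.harden.toSix.toList := by simp [toSix, harden, Six.toList]
  unfold stage1
  split_ifs with ha
  · have := (List.all_eq_true.mp ha) _ hmem
    rw [RawInput.stage1ok_harden_of_soft_pos h] at this
    exact absurd this (by decide)
  · rfl

/-- the same for M13 (the parent carries the C3 rows too). [folklore] -/
theorem stage1_harden_eq_FAIL_of_m13 {s : RawSix} (h : 0 < s.m13.tally.soft) : stage1 s.harden.toSix = .FAIL := by
  have hmem : s.m13.harden.toInput ∈ s.harden.toSix.toList := by simp [toSix, harden, Six.toList]
  unfold stage1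
  split_ifs with ha
  · have := (List.all_eq_true.mp ha) _ hmem
    rw [RawInput.stage1ok_harden_of_soft_pos h] at this
    exact absurd this (by decide)
  · rfl

end RawSix

/-! ### The La-214 six of 2026-08-29 (maps/run-2026-08-29zzu = RUN #268; goldens S123–S127) -/

/-- THE SIX AS PRINTED on maps/run-2026-08-29zzu: delivered ×6, router PARTIAL ×6 (words «UND:MIXED(…)+3BE» vs the
re-typed La-214 alternatives), kinds TN · ABSTAIN ×4 · ABSTAIN, hard 0, rejected none, soft 425 · 426 · 435 · 426 ·
423 · 125 (C3 energy-ordering rows + the older W8w/EW classes). [folklore] -/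
def lsco0829 : RawSix :=
  ⟨⟨true, .PARTIAL, .TN, ⟨0, 0, 425⟩⟩, ⟨true, .PARTIAL, .ABSTAIN, ⟨0, 0, 426⟩⟩, ⟨true, .PARTIAL, .ABSTAIN, ⟨0, 0, 435⟩⟩,
    ⟨true, .PARTIAL, .ABSTAIN, ⟨0, 0, 426⟩⟩, ⟨true, .PARTIAL, .ABSTAIN, ⟨0, 0, 423⟩⟩, ⟨true, .PARTIAL, .ABSTAIN, ⟨0, 0, 125⟩⟩⟩

/-- the same six with NO soft warnings (the pre-RUN-#252 diagnostic state of the words). [folklore] -/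
def lsco0829Bare : RawSix :=
  ⟨⟨true, .PARTIAL, .TN, ⟨0, 0, 0⟩⟩, ⟨true, .PARTIAL, .ABSTAIN, ⟨0, 0, 0⟩⟩, ⟨true, .PARTIAL, .ABSTAIN, ⟨0, 0, 0⟩⟩,
    ⟨true, .PARTIAL, .ABSTAIN, ⟨0, 0, 0⟩⟩, ⟨true, .PARTIAL, .ABSTAIN, ⟨0, 0, 0⟩⟩, ⟨true, .PARTIAL, .ABSTAIN, ⟨0, 0, 0⟩⟩⟩

/-- the printed six IS the bare six plus the soft counts. [folklore] -/
theorem lsco0829_eq_addSoft : lsco0829 = lsco0829Bare.addSoft 425 426 435 426 423 125 := rfl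

/-- STAGE 1 today = FAIL (clause «router AGREE on all six» — regression «PASS-TV2-today FAIL (router_AGREE_all_six)») … [folklore] -/
theorem stage1_lsco0829 : stage1 lsco0829.toSix = .FAIL := by decide

/-- … exactly as without the 2260 soft warnings: they are not why it fails. [folklore] -/
theorem stage1_lsco0829_bare : stage1 lsco0829Bare.toSix = .FAIL := by decide

/-- THE RE-ROUTED COUNTERFACTUAL: the same six with router AGREE ×6 (one re-worded La-214 input of record would give
it, part 3 `stage1_restore`), soft warnings as printed. [folklore] -/
def lscoRerouted : RawSix :=
  ⟨⟨true, .AGREE, .TN, ⟨0, 0, 425⟩⟩, ⟨true, .AGREE, .ABSTAIN, ⟨0, 0, 426⟩⟩, ⟨true, .AGREE, .ABSTAIN, ⟨0, 0, 435⟩⟩,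
    ⟨true, .AGREE, .ABSTAIN, ⟨0, 0, 426⟩⟩, ⟨true, .AGREE, .ABSTAIN, ⟨0, 0, 423⟩⟩, ⟨true, .AGREE, .ABSTAIN, ⟨0, 0, 125⟩⟩⟩

/-- re-routed, the six PASSES STAGE 1 with all 2260 soft warnings on it (they are read by no clause) … [folklore] -/
theorem stage1_lscoRerouted : stage1 lscoRerouted.toSix = .PASS := by decide

/-- … and FAILS it under the hardening engine: THIS is the only way the C3 class moves the PASS-TV2 word. [folklore] -/
theorem stage1_lscoRerouted_harden : stage1 lscoRerouted.harden.toSix = .FAIL :=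
  RawSix.stage1_harden_eq_FAIL_of_m15 (by decide)

/-- and then the 09-09 stage fails with it (no prerequisites), whatever the dome members. [folklore] -/
theorem stage2_lscoRerouted_harden (dm : Dome) : stage2 false lscoRerouted.harden.toSix.kinds dm = .FAIL := rfl

/-! ## §3 PASS-TV1 (H₃S) and PASS-TV3 (LK-99, Cu) -/

/-- the TV1 material with its two diagnostic bits taken from a tally. [folklore] -/
def TV1.withTally (x : TV1) (t : Tally) : TV1 := { x with wellFormed := t.wellFormed, hClean := t.hClean }

/-- PASS-TV1 does not see soft warnings. [folklore] -/
theorem tv1_withTally_addSoft (x : TV1) (t : Tally) (n : ℕ) : tv1 (x.withTally (t.addSoft n)) = tv1 (x.withTally t) := rfl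

/-- under the hardening engine a soft warning on the H₃S map fails PASS-TV1 (its H-clean clause). [folklore] -/
theorem tv1_withTally_harden {x : TV1} {t : Tally} (h : 0 < t.soft) : tv1 (x.withTally t.harden) = .FAIL :=
  tv1_eq_FAIL_of_not_hClean (by simp [TV1.withTally, Tally.hClean_harden_of_soft_pos h])

/-- a control with its two diagnostic bits taken from a tally. [folklore] -/
def Control.withTally (c : Control) (t : Tally) : Control := { c with wellFormed := t.wellFormed, hClean := t.hClean }

/-- the verdict kind of a control does not read the diagnostics. [folklore] -/
@[simp] theorem Control.kind_withTally (c : Control) (t : Tally) : (c.withTally t).kind = c.kind := rfl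

/-- PASS-TV3-LK99 does not see soft warnings. [folklore] -/
theorem tv3LK99_withTally_addSoft (c : Control) (t : Tally) (n : ℕ) :
    tv3LK99 (c.withTally (t.addSoft n)) = tv3LK99 (c.withTally t) := rfl

/-- under the hardening engine a soft warning on the LK-99 map fails PASS-TV3-LK99 (its H-clean clause). [folklore] -/
theorem tv3LK99_withTally_harden {c : Control} {t : Tally} (h : 0 < t.soft) : tv3LK99 (c.withTally t.harden) = .FAIL := by
  have hh : (c.withTally t.harden).hClean = false := by simp [Control.withTally, Tally.hClean_harden_of_soft_pos h]
  simp [tv3LK99, hh]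

/-- PASS-TV3-Cu does not see soft warnings … [folklore] -/
theorem tv3Cu_withTally_addSoft (c : Control) (t : Tally) (n : ℕ) :
    tv3Cu (c.withTally (t.addSoft n)) = tv3Cu (c.withTally t) := rfl

/-- … NOR HARDENED ONES: ACCEPTANCE §6.3's Cu clause list (verdict TN · every T ≥ 0.1 K cell «not» · FALSE-BAND 0 ·
router AGREE · well-formed) has no H-clean clause, so re-classifying the Cu map's warnings as incidents leaves the
PASS-TV3-Cu word where it was (the run-level structural verdict, not this clause, reads the incident). [folklore] -/
theorem tv3Cu_withTally_harden (c : Control) (t : Tally) : tv3Cu (c.withTally t.harden) = tv3Cu (c.withTally t) := by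
  simp [tv3Cu, Control.withTally, Control.kind]

/-- in particular a Cu map that PASSES keeps passing under the hardening engine with any number of soft warnings. [folklore] -/
theorem tv3Cu_pass_stable {c : Control} {t : Tally} (n : ℕ) (h : tv3Cu (c.withTally t) = .PASS) :
    tv3Cu (c.withTally (t.addSoft n).harden) = .PASS := by
  rw [tv3Cu_withTally_harden, tv3Cu_withTally_addSoft, h]

end WorkedExample

end Summit.Ventures.CertifiedManyBodySolver.Downfold
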